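import Literature.NumberTheory.EllipticCurves.ZpExtensionEisensteinAdicTower
import Literature.NumberTheory.GaloisCohomology.Howard2004.DVRKolyvaginBound
import HarnessLib

/-!
# The scalar action on the Eisenstein tower: part B's `AdicTower.smulFamily` (levelwise `H¹([f]·)` over `S_m`)
# IS the `Λ`-action of the pinned `H¹(K, T_𝔮)` (proved theorems; no named fact, no instance, no notation)

Topic `NumberTheory/EllipticCurves` (companion of `ZpExtensionEisensteinAdicTower`).  In the typed part B of Howard 2004
(`GaloisCohomology/Howard2004/DVRKolyvaginBound`, `AdicTower.smulFamily T r x k := scalarMapH1 (T.ρ k) (T.hlin k) r (x k)`,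
used by `IsFreeRankOneOn`, `KolyvaginSystem`, `Conclusion`) the coefficient ring `R = S_m` acts on families
`x ∈ Π_k H¹(K, T_k)` levelwise through x10b-p2's functorial scalar action; on the D1 side the pinned `H¹(K, T_𝔮)`
(`ZpExtension.eisensteinH1Limit`, p638876) is a `Λ`-module through `H¹([f]_{A_{m,k}} ·)` componentwise
(`coe_eisensteinH1LimitSMul_apply`).  For the Eisenstein tower `κ.eisensteinAdicTower ρ t hm ht` these agree:

* `scalarIntertwining_eisensteinAdicTower_eq` — the scalar endomorphism `[f]_{S_m} •` of level `k` IS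
  `κ.eisensteinTwistSMulHom (ρ k) hm k [f]_{A_{m,k}}` (same map);
* **`smulFamily_eisensteinAdicTower_mk`** — `T.smulFamily [f] x k = galoisCohomology.map (eisensteinTwistSMulHom … [f]) 1 (x k)`;
* **`coe_smul_eisensteinH1Limit`** — for `y ∈ H = eisensteinH1Limit`, `↑(f • y) = T.smulFamily [f] ↑y`: the inclusion
  `ι : H ↪ Π_k H¹(K, T_k)` (`Subtype.val`, image `T.limitH1` by `limitH1_eisensteinAdicTower_eq`) intertwines the
  `Λ`-action with `smulFamily` along `Λ ↠ S_m` — the «`ι (r • y) = smulFamily r (ι y)`» clause of the v9 glue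
  (x9-p1 LEAD g3, SKELETON-v9-PLAN addendum v2 / 15:11Z socket `nonempty_specWitness_of_dvrConclusion`).

Howard §1.6 (arXiv:1202.6340 p. 12, L29–55: `H¹_F(K, T)` as an `R`-module through the tower); §2.2 / Def. 2.2.3
(`H¹(K, T_𝔮)` as an `S_𝔮`-module).  BSD is not proved by any of this.
-/

noncomputable section

open scoped TensorProduct ContRepresentation
open Field IsLocalRing

namespace Literature.NumberTheory.EllipticCurves.ZpExtension

open Literature.NumberTheory.GaloisRepresentations
open Literature.NumberTheory.GaloisCohomology.Howard2004

variable {K : Type} [Field K] {p : ℕ} [hp : Fact p.Prime] (κ : ZpExtension K p)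
  {M : ℕ → Type} [∀ k, AddCommGroup (M k)] [∀ k, TopologicalSpace (M k)] [∀ k, DiscreteTopology (M k)]
  (ρ : ∀ k, DiscreteGaloisModule K (M k))
  (t : ∀ k, (ρ (k + 1)).toContRepresentation →ⁱL (ρ k).toContRepresentation)
  {m : ℕ} (hm : 1 ≤ m)

/-- **The scalar endomorphism `[f]_{S_m} •` of the level `M_k ⊗ A_{m,k}(ψ)` of the Eisenstein tower is
`eisensteinTwistSMulHom … [f]_{A_{m,k}}`** (the `S_m`-action on `EisensteinLevel` is through `S_m ↠ A_{m,k}`; same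
continuous intertwining map). [cite: Howard2004HeegnerKolyvagin, §2.2 and Def. 2.2.3 (H¹(K, T_𝔮) as an S_𝔮-module)] -/
theorem scalarIntertwining_eisensteinAdicTower_eq (ht : ∀ k, Function.Surjective (t k)) (k : ℕ)
    (f : IwasawaAlgebra p) :
    letI := IwasawaAlgebra.isLocalRing_quotient_X_pow_add_C p hm
    DiscreteGaloisModule.scalarIntertwining ((κ.eisensteinAdicTower ρ t hm ht).ρ k)
        ((κ.eisensteinAdicTower ρ t hm ht).hlin k)
        (Ideal.Quotient.mk
          (Ideal.span {(PowerSeries.X ^ m + PowerSeries.C (p : ℤ_[p]) : IwasawaAlgebra p)}) f) =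
      κ.eisensteinTwistSMulHom (ρ k) hm k (Ideal.Quotient.mk _ f) :=
  rfl

/-- **Part B's `smulFamily` on the Eisenstein tower is D1's componentwise `H¹([f]_{A_{m,k}} ·)`**:
`T.smulFamily [f]_{S_m} x k = galoisCohomology.map (κ.eisensteinTwistSMulHom (ρ k) hm k [f]) 1 (x k)`.
[cite: Howard2004HeegnerKolyvagin, §1.6 (arXiv p. 12, L29–55) and §2.2, Def. 2.2.3] [cite: SerreGaloisCohomology1997, I §2.2] -/
theorem smulFamily_eisensteinAdicTower_mk (ht : ∀ k, Function.Surjective (t k)) (f : IwasawaAlgebra p) :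
    letI := IwasawaAlgebra.isLocalRing_quotient_X_pow_add_C p hm
    ∀ (x : ∀ k, galoisCohomology ((κ.eisensteinAdicTower ρ t hm ht).ρ k) 1) (k : ℕ),
      (κ.eisensteinAdicTower ρ t hm ht).smulFamily
          (Ideal.Quotient.mk
            (Ideal.span {(PowerSeries.X ^ m + PowerSeries.C (p : ℤ_[p]) : IwasawaAlgebra p)}) f) x k =
        galoisCohomology.map (κ.eisensteinTwistSMulHom (ρ k) hm k (Ideal.Quotient.mk _ f)) 1 (x k) := by
  letI := IwasawaAlgebra.isLocalRing_quotient_X_pow_add_C p hm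
  intro x k
  exact congrArg (fun g ↦ galoisCohomology.map g 1 (x k))
    (κ.scalarIntertwining_eisensteinAdicTower_eq ρ t hm ht k f)

/-- **The inclusion `ι : H¹(K, T_𝔮) = lim ↪ Π_k H¹(K, T_𝔮/p^k)` intertwines the `Λ`-action of the pinned
`eisensteinH1Limit` (its `module` field `eisensteinH1LimitModule`, on the carrier `eisensteinH1LimitCarrier = eisensteinH1Limit.H`)
with part B's `smulFamily` along `Λ ↠ S_m`**: `↑(f • y) = T.smulFamily [f]_{S_m} ↑y`.
[cite: Howard2004HeegnerKolyvagin, §1.6 (arXiv p. 12, L29–55: H¹_F(K,T) as an R-module through the tower) and §2.2, Def. 2.2.3 (H¹(K, T_𝔮) as an S_𝔮-module)] -/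
theorem coe_smul_eisensteinH1Limit (ht : ∀ k, Function.Surjective (t k)) (f : IwasawaAlgebra p)
    (y : κ.eisensteinH1LimitCarrier ρ t hm) :
    letI := IwasawaAlgebra.isLocalRing_quotient_X_pow_add_C p hm
    letI := κ.eisensteinH1LimitModule ρ t hm
    ((f • y : κ.eisensteinH1LimitCarrier ρ t hm) : Π k, galoisCohomology (κ.eisensteinTwist (ρ k) hm k) 1) =
      (κ.eisensteinAdicTower ρ t hm ht).smulFamily
        (Ideal.Quotient.mk
          (Ideal.span {(PowerSeries.X ^ m + PowerSeries.C (p : ℤ_[p]) : IwasawaAlgebra p)}) f)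
        (y : Π k, galoisCohomology (κ.eisensteinTwist (ρ k) hm k) 1) := by
  letI := IwasawaAlgebra.isLocalRing_quotient_X_pow_add_C p hm
  letI := κ.eisensteinH1LimitModule ρ t hm
  funext k
  exact (κ.coe_eisensteinH1LimitSMul_apply ρ t hm f y k).trans
    (κ.smulFamily_eisensteinAdicTower_mk ρ t hm ht f
      (y : Π k, galoisCohomology (κ.eisensteinTwist (ρ k) hm k) 1) k).symm

/-- The same for the SHIFTED tower `eisensteinAdicTowerSucc` (levels from `1`): `smulFamily [f] x k` is
`H¹([f]_{A_{m,k+1}} ·)` on the component `x k ∈ H¹(K, M_{k+1} ⊗ A_{m,k+1})`.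
[cite: Howard2004HeegnerKolyvagin, §1.6 (arXiv p. 12, L29–55) and §2.2] -/
theorem smulFamily_eisensteinAdicTowerSucc_mk (ht : ∀ k, Function.Surjective (t k)) (f : IwasawaAlgebra p) :
    letI := IwasawaAlgebra.isLocalRing_quotient_X_pow_add_C p hm
    ∀ (x : ∀ k, galoisCohomology ((κ.eisensteinAdicTowerSucc ρ t hm ht).ρ k) 1) (k : ℕ),
      (κ.eisensteinAdicTowerSucc ρ t hm ht).smulFamily
          (Ideal.Quotient.mk
            (Ideal.span {(PowerSeries.X ^ m + PowerSeries.C (p : ℤ_[p]) : IwasawaAlgebra p)}) f) x k =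
        galoisCohomology.map (κ.eisensteinTwistSMulHom (ρ (k + 1)) hm (k + 1) (Ideal.Quotient.mk _ f)) 1 (x k) := by
  letI := IwasawaAlgebra.isLocalRing_quotient_X_pow_add_C p hm
  intro x k
  exact congrArg (fun g ↦ galoisCohomology.map g 1 (x k))
    (show DiscreteGaloisModule.scalarIntertwining ((κ.eisensteinAdicTowerSucc ρ t hm ht).ρ k)
        ((κ.eisensteinAdicTowerSucc ρ t hm ht).hlin k) (Ideal.Quotient.mk _ f) =
      κ.eisensteinTwistSMulHom (ρ (k + 1)) hm (k + 1) (Ideal.Quotient.mk _ f) from rfl)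

end Literature.NumberTheory.EllipticCurves.ZpExtension

end
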